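import Literature.RingTheory.MvPolynomial.HypersurfaceFlecnodalLine
import Mathlib.RingTheory.Polynomial.Resultant.Basic
import HarnessLib

/-!
# The chart flecnode numerators of a surface and their resultant

Topic `Literature/RingTheory/MvPolynomial`. Everything in this file is PROVED. Polynomial
("cleared-denominator") versions `N₁, N₂, N₃ ∈ K[x][σ]` of the osculating polynomials
`T₁, T₂, T₃ ∈ L[σ]` of `HypersurfaceLineTaylor.lean` (`N̄_k = F̄^{2k-1} T_k`, `F = ∂₂f`), built
with the numerator derivation `𝒟̂ = D̂₀ + σD̂₁`, `D̂ₐ = ∂₂f·∂ₐ - ∂ₐf·∂₂` (so that no division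
occurs), and the **chart flecnode polynomial** `R(f) = Res_σ^{2,3}(N₂, N₃) ∈ K[x]`:

* `Hypersurface.map_num₂`, `Hypersurface.map_num₃` — `N̄₂ = F̄³T₂`, `N̄₃ = F̄⁵T₃` in `L[σ]`;
* `Hypersurface.totalDegree_flecRes_le` — `deg R(f) ≤ 19 (d - 1)`;
* `Hypersurface.eval_flecRes_eq_zero_of_line` — `R(f)` vanishes at every point of every
  line of the surface whose direction has non-zero first coordinate (along such a line
  `ℓ = {p + t(1, σ₀, w₀)}` one has `𝒟̂P|_ℓ = F|_ℓ · (P|_ℓ)'`, whence `N₁|_ℓ = w₀F|_ℓ`,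
  `N₂|_ℓ = N₃|_ℓ = 0`, and `σ₀` is a common root of `N₂(p;σ), N₃(p;σ)`).

This is the elementary content of the flecnode polynomial of [Kollar2015, ¶38–39] in an affine
chart (degree `19(d-1)` instead of Salmon's `11d - 24`).

## References
* [Kollar2015] J. Kollár, *Szemerédi–Trotter-type theorems in dimension 3*, Adv. Math. 271
  (2015), ¶38–39 and Theorem 13.
-/

namespace Literature.RingTheory.MvPolynomial

open Polynomial
open scoped Nat

/-! ### The chain rule along an affine line -/

section ChainRule

variable {R : Type*} [CommRing R] {σ : Type*} [Fintype σ] [DecidableEq σ]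

/-- **Chain rule along a line**: `d/dt g(p + tv) = Σₐ vₐ (∂ₐg)(p + tv)`. [folklore] -/
theorem derivative_aeval_line (p v : σ → R) (g : MvPolynomial σ R) :
    derivative (MvPolynomial.aeval (fun i => C (p i) + C (v i) * X) g) =
      ∑ a, C (v a) * MvPolynomial.aeval (fun i => C (p i) + C (v i) * X)
        (MvPolynomial.pderiv a g) := by
  induction g using MvPolynomial.induction_on with
  | C c =>
    simp only [MvPolynomial.algHom_C, Polynomial.algebraMap_apply, Algebra.algebraMap_self,
      RingHom.id_apply, derivative_C, MvPolynomial.pderiv_C, map_zero, mul_zero,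
      Finset.sum_const_zero]
  | add p₁ p₂ h₁ h₂ =>
    simp only [map_add, h₁, h₂, mul_add, Finset.sum_add_distrib]
  | mul_X q i hq =>
    rw [map_mul, MvPolynomial.aeval_X, derivative_mul, derivative_add, derivative_C,
      derivative_C_mul_X, zero_add, hq, Finset.sum_mul]
    have hsum : ∀ a, C (v a) * MvPolynomial.aeval (fun i => C (p i) + C (v i) * X)
        (MvPolynomial.pderiv a (q * MvPolynomial.X i)) =
        C (v a) * MvPolynomial.aeval (fun i => C (p i) + C (v i) * X) (MvPolynomial.pderiv a q)
          * (C (p i) + C (v i) * X) +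
        (if i = a then MvPolynomial.aeval (fun i => C (p i) + C (v i) * X) q * C (v i)
          else 0) := by
      intro a
      rw [Derivation.leibniz, MvPolynomial.pderiv_X, Pi.single_apply, smul_eq_mul, smul_eq_mul,
        map_add, map_mul, map_mul, MvPolynomial.aeval_X]
      split_ifs with h
      · subst h; rw [map_one]; ring
      · rw [map_zero]; ring
    simp only [hsum, Finset.sum_add_distrib, Finset.sum_ite_eq, Finset.mem_univ, if_true]

omit [Fintype σ] [DecidableEq σ] in
/-- If `g(p + tv) ≡ 0` then `g(p) = 0`. [folklore] -/
theorem eval_eq_zero_of_aeval_line_eq_zero {F : Type*} [Field F] (p v : σ → F)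
    {g : MvPolynomial σ F} (h : MvPolynomial.aeval (fun i => C (p i) + C (v i) * X) g = 0) :
    MvPolynomial.eval p g = 0 := by
  have key := Literature.Combinatorics.Extremal.eval_aeval_line p v g 0
  rwa [h, eval_zero, zero_smul, add_zero, eq_comm] at key

end ChainRule

/-! ### Polynomials with vanishing derivative in small degree are constant -/

section DerivZero

variable {K : Type*} [Field K]

/-- If `P' = 0` and `n ≠ 0` in `K` for `1 ≤ n ≤ deg P`, then `P` is constant. [folklore] -/
theorem eq_C_of_derivative_eq_zero {P : K[X]} (h : derivative P = 0)
    (hfac : ∀ n, 1 ≤ n → n ≤ P.natDegree → (n : K) ≠ 0) : P = C (P.coeff 0) := by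
  refine Polynomial.ext fun n => ?_
  rw [coeff_C]
  match n with
  | 0 => rw [if_pos rfl]
  | n + 1 =>
    rw [if_neg (Nat.succ_ne_zero n)]
    by_cases hn : n + 1 ≤ P.natDegree
    · have hc := congrArg (fun Q => Q.coeff n) h
      simp only [coeff_derivative, coeff_zero] at hc
      rcases mul_eq_zero.1 hc with h0 | h0
      · exact h0
      · exact absurd (by exact_mod_cast h0) (hfac (n + 1) (by omega) hn)
    · exact coeff_eq_zero_of_natDegree_lt (by omega)

end DerivZero

/-! ### Degree bookkeeping for polynomials in `σ` with coefficients in `K[x]` -/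

section CoeffDegree

variable {R : Type*} [CommRing R] {τ : Type*}

/-- Sums: if all `σ`-coefficients of `P` and `Q` have total degree `≤ e`, so does `P + Q`.
[folklore] -/
theorem coeffDeg_add {P Q : Polynomial (MvPolynomial τ R)} {e : ℕ}
    (hP : ∀ i, (P.coeff i).totalDegree ≤ e) (hQ : ∀ i, (Q.coeff i).totalDegree ≤ e) (i : ℕ) :
    ((P + Q).coeff i).totalDegree ≤ e := by
  rw [coeff_add]
  exact (MvPolynomial.totalDegree_add _ _).trans (max_le (hP i) (hQ i))

/-- Negation. [folklore] -/
theorem coeffDeg_neg {P : Polynomial (MvPolynomial τ R)} {e : ℕ}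
    (hP : ∀ i, (P.coeff i).totalDegree ≤ e) (i : ℕ) : ((-P).coeff i).totalDegree ≤ e := by
  rw [coeff_neg, MvPolynomial.totalDegree_neg]; exact hP i

/-- Differences. [folklore] -/
theorem coeffDeg_sub {P Q : Polynomial (MvPolynomial τ R)} {e : ℕ}
    (hP : ∀ i, (P.coeff i).totalDegree ≤ e) (hQ : ∀ i, (Q.coeff i).totalDegree ≤ e) (i : ℕ) :
    ((P - Q).coeff i).totalDegree ≤ e := by
  rw [sub_eq_add_neg]; exact coeffDeg_add hP (coeffDeg_neg hQ) i

/-- Products. [folklore] -/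
theorem coeffDeg_mul {P Q : Polynomial (MvPolynomial τ R)} {e e' : ℕ}
    (hP : ∀ i, (P.coeff i).totalDegree ≤ e) (hQ : ∀ i, (Q.coeff i).totalDegree ≤ e') (i : ℕ) :
    ((P * Q).coeff i).totalDegree ≤ e + e' := by
  rw [coeff_mul]
  refine (MvPolynomial.totalDegree_finsetSum _ _).trans (Finset.sup_le fun x _ => ?_)
  exact (MvPolynomial.totalDegree_mul _ _).trans (Nat.add_le_add (hP _) (hQ _))

/-- Natural multiples. [folklore] -/
theorem coeffDeg_nsmul {P : Polynomial (MvPolynomial τ R)} {e : ℕ}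
    (hP : ∀ i, (P.coeff i).totalDegree ≤ e) (n : ℕ) (i : ℕ) :
    ((n • P).coeff i).totalDegree ≤ e := by
  induction n generalizing i with
  | zero => simp
  | succ n ih => rw [succ_nsmul]; exact coeffDeg_add ih hP i

/-- Constants. [folklore] -/
theorem coeffDeg_C {g : MvPolynomial τ R} {e : ℕ} (hg : g.totalDegree ≤ e) (i : ℕ) :
    ((C g).coeff i).totalDegree ≤ e := by
  rw [coeff_C]
  split_ifs
  · exact hg
  · rw [MvPolynomial.totalDegree_zero]; exact Nat.zero_le _

/-- Multiplication by `σ`. [folklore] -/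
theorem coeffDeg_X_mul {P : Polynomial (MvPolynomial τ R)} {e : ℕ}
    (hP : ∀ i, (P.coeff i).totalDegree ≤ e) (i : ℕ) : ((X * P).coeff i).totalDegree ≤ e := by
  match i with
  | 0 => rw [coeff_X_mul_zero, MvPolynomial.totalDegree_zero]; exact Nat.zero_le _
  | i + 1 => rw [coeff_X_mul]; exact hP i

/-- **Row-wise degree bound for the resultant.** If the coefficients of `P` have total degree
`≤ a` and those of `Q` total degree `≤ b`, then `Res_{m,n}(P, Q)` has total degree
`≤ n a + m b` (Sylvester determinant: `n` columns of `P`-coefficients, `m` of `Q`-coefficients).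
[folklore] -/
theorem totalDegree_resultant_le_of_coeffDeg {P Q : Polynomial (MvPolynomial τ R)}
    {a b : ℕ} (hP : ∀ i, (P.coeff i).totalDegree ≤ a) (hQ : ∀ i, (Q.coeff i).totalDegree ≤ b)
    (m n : ℕ) : (resultant P Q m n).totalDegree ≤ n * a + m * b := by
  classical
  rw [resultant, Matrix.det_apply]
  refine (MvPolynomial.totalDegree_finsetSum _ _).trans (Finset.sup_le fun π _ => ?_)
  refine (MvPolynomial.totalDegree_smul_le _ _).trans ?_
  refine (MvPolynomial.totalDegree_finsetProd _ _).trans ?_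
  -- entry bound: column `j` contributes `≤ b` on the first `m` columns, `≤ a` on the last `n`
  have hentry : ∀ (i j : Fin (m + n)), (sylvester P Q m n i j).totalDegree ≤
      Fin.addCases (fun _ => b) (fun _ => a) j := by
    intro i j
    rw [sylvester, Matrix.of_apply]
    induction j using Fin.addCases with
    | left j =>
      rw [Fin.addCases_left, Fin.addCases_left]
      split_ifs
      · exact hQ _
      · rw [MvPolynomial.totalDegree_zero]; exact Nat.zero_le _
    | right j =>
      rw [Fin.addCases_right, Fin.addCases_right]
      split_ifs
      · exact hP _
      · rw [MvPolynomial.totalDegree_zero]; exact Nat.zero_le _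
  calc ∑ j, (sylvester P Q m n (π j) j).totalDegree
      ≤ ∑ j : Fin (m + n), Fin.addCases (fun _ => b) (fun _ => a) j :=
        Finset.sum_le_sum fun j _ => hentry _ _
    _ = n * a + m * b := by
        rw [Fin.sum_univ_add]
        simp only [Fin.addCases_left, Fin.addCases_right, Finset.sum_const, Finset.card_univ,
          Fintype.card_fin, smul_eq_mul]
        ring

end CoeffDegree

/-! ### The numerator derivation and the numerators `N₁, N₂, N₃` -/

namespace Hypersurface

variable {K : Type*} [Field K] (f : MvPolynomial (Fin 3) K)

/-- **The numerator derivation** `𝒟̂ = D̂₀ + σ D̂₁` of `K[x][σ]`, `D̂ₐ = ∂₂f·∂ₐ - ∂ₐf·∂₂`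
acting on coefficients (`= ∂₂f · 𝒟` modulo `f`, without denominators). [folklore] -/
noncomputable def numDeriv :
    Derivation K (Polynomial (MvPolynomial (Fin 3) K)) (Polynomial (MvPolynomial (Fin 3) K)) :=
  (tangentDeriv f 0).coeffwise +
    (X : Polynomial (MvPolynomial (Fin 3) K)) • (tangentDeriv f 1).coeffwise

/-- `𝒟̂ (C g) = C (D̂₀ g) + σ C (D̂₁ g)`. [folklore] -/
theorem numDeriv_C (g : MvPolynomial (Fin 3) K) :
    numDeriv f (C g) = C (tangentDeriv f 0 g) + X * C (tangentDeriv f 1 g) := by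
  rw [numDeriv, Derivation.add_apply, Derivation.smul_apply, Derivation.coeffwise_C,
    Derivation.coeffwise_C, smul_eq_mul]

/-- `𝒟̂ σ = 0`. [folklore] -/
theorem numDeriv_X : numDeriv f X = 0 := by
  rw [numDeriv, Derivation.add_apply, Derivation.smul_apply, Derivation.coeffwise_X,
    Derivation.coeffwise_X, smul_zero, add_zero]

/-- `𝒟̂ (C g σⁿ) = σⁿ 𝒟̂ (C g)`. [folklore] -/
theorem numDeriv_C_mul_X_pow (g : MvPolynomial (Fin 3) K) (n : ℕ) :
    numDeriv f (C g * X ^ n) = X ^ n * numDeriv f (C g) := by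
  rw [Derivation.leibniz, Derivation.leibniz_pow, numDeriv_X, smul_zero, smul_zero, smul_zero,
    zero_add, smul_eq_mul]

/-- `N₁ = -(∂₀f + σ ∂₁f)` (`= ∂₂f · T₁` modulo `f`). [folklore] -/
noncomputable def num₁ : Polynomial (MvPolynomial (Fin 3) K) :=
  -(C (MvPolynomial.pderiv 0 f) + X * C (MvPolynomial.pderiv 1 f))

/-- `N₂ = ∂₂f · 𝒟̂N₁ - N₁ · 𝒟̂(∂₂f)` (`= (∂₂f)³ T₂` modulo `f`). [folklore] -/
noncomputable def num₂ : Polynomial (MvPolynomial (Fin 3) K) :=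
  C (MvPolynomial.pderiv 2 f) * numDeriv f (num₁ f) -
    num₁ f * numDeriv f (C (MvPolynomial.pderiv 2 f))

/-- `N₃ = ∂₂f · 𝒟̂N₂ - 3 N₂ · 𝒟̂(∂₂f)` (`= (∂₂f)⁵ T₃` modulo `f`). [folklore] -/
noncomputable def num₃ : Polynomial (MvPolynomial (Fin 3) K) :=
  C (MvPolynomial.pderiv 2 f) * numDeriv f (num₂ f) -
    3 • (num₂ f * numDeriv f (C (MvPolynomial.pderiv 2 f)))

/-- **The chart flecnode polynomial** `R(f) = Res_σ^{2,3}(N₂, N₃) ∈ K[x]`. [folklore] -/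
noncomputable def flecRes : MvPolynomial (Fin 3) K := resultant (num₂ f) (num₃ f) 2 3

/-! ### `σ`-degrees -/

/-- `𝒟̂` raises the `σ`-degree by at most one. [folklore] -/
theorem natDegree_numDeriv_le (P : Polynomial (MvPolynomial (Fin 3) K)) :
    (numDeriv f P).natDegree ≤ P.natDegree + 1 := by
  have hcw : ∀ a, ((tangentDeriv f a).coeffwise P).natDegree ≤ P.natDegree := by
    intro a
    refine natDegree_le_iff_coeff_eq_zero.2 fun i hi => ?_
    rw [Derivation.coeff_coeffwise, coeff_eq_zero_of_natDegree_lt (by exact_mod_cast hi),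
      map_zero]
  rw [numDeriv, Derivation.add_apply, Derivation.smul_apply, smul_eq_mul]
  refine (natDegree_add_le _ _).trans (max_le ((hcw 0).trans (Nat.le_succ _)) ?_)
  refine natDegree_mul_le.trans ?_
  rw [add_comm]
  exact Nat.add_le_add (hcw 1) natDegree_X_le

/-- `deg_σ N₁ ≤ 1`. [folklore] -/
theorem natDegree_num₁_le : (num₁ f).natDegree ≤ 1 := by
  rw [num₁, natDegree_neg]
  refine (natDegree_add_le _ _).trans (max_le (by rw [natDegree_C]; exact Nat.zero_le _) ?_)
  refine natDegree_mul_le.trans ?_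
  rw [natDegree_C, add_zero]
  exact natDegree_X_le

/-- `deg_σ 𝒟̂(C g) ≤ 1`. [folklore] -/
theorem natDegree_numDeriv_C_le (g : MvPolynomial (Fin 3) K) :
    (numDeriv f (C g)).natDegree ≤ 1 := by
  refine (natDegree_numDeriv_le f _).trans ?_
  rw [natDegree_C]

/-- `deg_σ N₂ ≤ 2`. [folklore] -/
theorem natDegree_num₂_le : (num₂ f).natDegree ≤ 2 := by
  rw [num₂]
  refine (natDegree_sub_le _ _).trans (max_le ?_ ?_)
  · refine natDegree_mul_le.trans ?_
    rw [natDegree_C, zero_add]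
    exact (natDegree_numDeriv_le f _).trans (Nat.add_le_add_right (natDegree_num₁_le f) 1)
  · refine natDegree_mul_le.trans ?_
    exact Nat.add_le_add (natDegree_num₁_le f) (natDegree_numDeriv_C_le f _)

/-- `deg_σ N₃ ≤ 3`. [folklore] -/
theorem natDegree_num₃_le : (num₃ f).natDegree ≤ 3 := by
  rw [num₃]
  refine (natDegree_sub_le _ _).trans (max_le ?_ ?_)
  · refine natDegree_mul_le.trans ?_
    rw [natDegree_C, zero_add]
    exact (natDegree_numDeriv_le f _).trans (Nat.add_le_add_right (natDegree_num₂_le f) 1)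
  · refine (natDegree_smul_le _ _).trans (natDegree_mul_le.trans ?_)
    exact Nat.add_le_add (natDegree_num₂_le f) (natDegree_numDeriv_C_le f _)

/-! ### `x`-degrees of the coefficients -/

/-- `D̂ₐ` raises the total degree of coefficients by at most `d - 1`. [folklore] -/
theorem coeffDeg_coeffwise_tangentDeriv (a : Fin 3) {P : Polynomial (MvPolynomial (Fin 3) K)}
    {e : ℕ} (hP : ∀ i, (P.coeff i).totalDegree ≤ e) (i : ℕ) :
    (((tangentDeriv f a).coeffwise P).coeff i).totalDegree ≤ e + (f.totalDegree - 1) := by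
  rw [Derivation.coeff_coeffwise, tangentDeriv_apply]
  refine (MvPolynomial.totalDegree_sub _ _).trans (max_le ?_ ?_)
  · refine (MvPolynomial.totalDegree_mul _ _).trans ?_
    rw [add_comm]
    exact Nat.add_le_add ((Ruppert.totalDegree_pderiv_le a _).trans ((Nat.sub_le _ _).trans
      (hP i))) (Ruppert.totalDegree_pderiv_le 2 f)
  · refine (MvPolynomial.totalDegree_mul _ _).trans ?_
    rw [add_comm]
    exact Nat.add_le_add ((Ruppert.totalDegree_pderiv_le 2 _).trans ((Nat.sub_le _ _).trans
      (hP i))) (Ruppert.totalDegree_pderiv_le a f)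

/-- `𝒟̂` raises the total degree of coefficients by at most `d - 1`. [folklore] -/
theorem coeffDeg_numDeriv {P : Polynomial (MvPolynomial (Fin 3) K)} {e : ℕ}
    (hP : ∀ i, (P.coeff i).totalDegree ≤ e) (i : ℕ) :
    ((numDeriv f P).coeff i).totalDegree ≤ e + (f.totalDegree - 1) := by
  rw [numDeriv, Derivation.add_apply, Derivation.smul_apply, smul_eq_mul]
  exact coeffDeg_add (coeffDeg_coeffwise_tangentDeriv f 0 hP)
    (coeffDeg_X_mul (coeffDeg_coeffwise_tangentDeriv f 1 hP)) i

/-- Coefficients of `N₁` have degree `≤ d - 1`. [folklore] -/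
theorem coeffDeg_num₁ (i : ℕ) : ((num₁ f).coeff i).totalDegree ≤ f.totalDegree - 1 := by
  rw [num₁]
  exact coeffDeg_neg (coeffDeg_add (coeffDeg_C (Ruppert.totalDegree_pderiv_le 0 f))
    (coeffDeg_X_mul (coeffDeg_C (Ruppert.totalDegree_pderiv_le 1 f)))) i

/-- Coefficients of `N₂` have degree `≤ 3 (d - 1)`. [folklore] -/
theorem coeffDeg_num₂ (i : ℕ) : ((num₂ f).coeff i).totalDegree ≤ 3 * (f.totalDegree - 1) := by
  rw [num₂]
  refine (coeffDeg_sub (e := 3 * (f.totalDegree - 1)) (fun i => ?_) (fun i => ?_) i)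
  · exact (coeffDeg_mul (coeffDeg_C (Ruppert.totalDegree_pderiv_le 2 f))
      (coeffDeg_numDeriv f (coeffDeg_num₁ f)) i).trans (by omega)
  · exact (coeffDeg_mul (coeffDeg_num₁ f) (coeffDeg_numDeriv f
      (coeffDeg_C (Ruppert.totalDegree_pderiv_le 2 f))) i).trans (by omega)

/-- Coefficients of `N₃` have degree `≤ 5 (d - 1)`. [folklore] -/
theorem coeffDeg_num₃ (i : ℕ) : ((num₃ f).coeff i).totalDegree ≤ 5 * (f.totalDegree - 1) := by
  rw [num₃]
  refine (coeffDeg_sub (e := 5 * (f.totalDegree - 1)) (fun i => ?_) (fun i => ?_) i)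
  · exact (coeffDeg_mul (coeffDeg_C (Ruppert.totalDegree_pderiv_le 2 f))
      (coeffDeg_numDeriv f (coeffDeg_num₂ f)) i).trans (by omega)
  · refine coeffDeg_nsmul (e := 5 * (f.totalDegree - 1)) (fun i => ?_) 3 i
    exact (coeffDeg_mul (coeffDeg_num₂ f) (coeffDeg_numDeriv f
      (coeffDeg_C (Ruppert.totalDegree_pderiv_le 2 f))) i).trans (by omega)

/-- **Degree of the chart flecnode polynomial**: `deg R(f) ≤ 19 (d - 1)`. [folklore] -/
theorem totalDegree_flecRes_le : (flecRes f).totalDegree ≤ 19 * (f.totalDegree - 1) :=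
  (totalDegree_resultant_le_of_coeffDeg (coeffDeg_num₂ f) (coeffDeg_num₃ f) 2 3).trans
    (by omega)

/-! ### The numerators modulo `f`: `N̄₁ = F̄T₁`, `N̄₂ = F̄³T₂`, `N̄₃ = F̄⁵T₃` -/

section ModF

variable [Fact (Irreducible f)]

/-- `D̂ₐ g ≡ ∂₂f · Dₐ ḡ` modulo `f`. [folklore] -/
theorem toFn_tangentDeriv (h2 : toFn f (MvPolynomial.pderiv 2 f) ≠ 0) (a : Fin 3)
    (g : MvPolynomial (Fin 3) K) :
    toFn f (tangentDeriv f a g) = toFn f (MvPolynomial.pderiv 2 f) * gD f a (toFn f g) := by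
  rw [gD_toFn_raw, tangentDeriv_apply, map_sub, map_mul, map_mul, ← mul_assoc,
    mul_inv_cancel₀ h2, one_mul]

/-- `θ (𝒟̂ (C g)) = C F̄ · 𝒟 (C ḡ)` (`θ` = reduction modulo `f`). [folklore] -/
theorem map_numDeriv_C (h2 : toFn f (MvPolynomial.pderiv 2 f) ≠ 0)
    (g : MvPolynomial (Fin 3) K) :
    (numDeriv f (C g)).map (toFn f : MvPolynomial (Fin 3) K →+* FnField f) =
      C (toFn f (MvPolynomial.pderiv 2 f)) * slopeDeriv f (C (toFn f g)) := by
  rw [numDeriv_C, Polynomial.map_add, Polynomial.map_mul, Polynomial.map_C, Polynomial.map_C,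
    Polynomial.map_X, slopeDeriv_C, RingHom.coe_coe, toFn_tangentDeriv f h2,
    toFn_tangentDeriv f h2, map_mul, map_mul]
  ring

/-- `𝒟 (σⁿ) = 0`. [folklore] -/
theorem slopeDeriv_X_pow (n : ℕ) : slopeDeriv f ((X : Polynomial (FnField f)) ^ n) = 0 := by
  induction n with
  | zero => rw [pow_zero]; exact Derivation.map_one_eq_zero _
  | succ n ih => rw [pow_succ, Derivation.leibniz, slopeDeriv_X, ih, smul_zero, smul_zero, add_zero]

/-- `𝒟` raises the `σ`-degree by at most one. [folklore] -/
theorem natDegree_slopeDeriv_le (P : Polynomial (FnField f)) :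
    (slopeDeriv f P).natDegree ≤ P.natDegree + 1 := by
  have hcw : ∀ a, (cw f (gD f a) P).natDegree ≤ P.natDegree := by
    intro a
    refine natDegree_le_iff_coeff_eq_zero.2 fun i hi => ?_
    rw [coeff_cw, coeff_eq_zero_of_natDegree_lt (by exact_mod_cast hi), map_zero]
  rw [slopeDeriv, Derivation.add_apply, Derivation.smul_apply, smul_eq_mul]
  refine (natDegree_add_le _ _).trans (max_le ((hcw 0).trans (Nat.le_succ _)) ?_)
  refine natDegree_mul_le.trans ?_
  rw [add_comm]
  exact Nat.add_le_add (hcw 1) natDegree_X_le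

/-- `deg_σ T_k ≤ k`. [folklore] -/
theorem natDegree_osc_le (k : ℕ) : (osc f k).natDegree ≤ k := by
  induction k with
  | zero => rw [osc_zero, natDegree_C]
  | succ k ih => rw [osc_succ]; exact (natDegree_slopeDeriv_le f _).trans (Nat.succ_le_succ ih)

/-- `θ (𝒟̂ P) = C F̄ · 𝒟 (θ P)`. [folklore] -/
theorem map_numDeriv (h2 : toFn f (MvPolynomial.pderiv 2 f) ≠ 0)
    (P : Polynomial (MvPolynomial (Fin 3) K)) :
    (numDeriv f P).map (toFn f : MvPolynomial (Fin 3) K →+* FnField f) =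
      C (toFn f (MvPolynomial.pderiv 2 f)) *
        slopeDeriv f (P.map (toFn f : MvPolynomial (Fin 3) K →+* FnField f)) := by
  induction P using Polynomial.induction_on with
  | C g => rw [map_numDeriv_C f h2, Polynomial.map_C, RingHom.coe_coe]
  | add p₁ p₂ h₁ h₂ =>
    rw [map_add, Polynomial.map_add, h₁, h₂, Polynomial.map_add, map_add, mul_add]
  | monomial n g _ =>
    rw [numDeriv_C_mul_X_pow, Polynomial.map_mul, Polynomial.map_pow, Polynomial.map_X,
      map_numDeriv_C f h2, Polynomial.map_mul, Polynomial.map_pow, Polynomial.map_X,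
      Polynomial.map_C, RingHom.coe_coe, Derivation.leibniz, slopeDeriv_X_pow, smul_zero, zero_add,
      smul_eq_mul]
    ring

/-- `N̄₁ = F̄ T₁`. [folklore] -/
theorem map_num₁ (h2 : toFn f (MvPolynomial.pderiv 2 f) ≠ 0) :
    (num₁ f).map (toFn f : MvPolynomial (Fin 3) K →+* FnField f) =
      C (toFn f (MvPolynomial.pderiv 2 f)) * osc f 1 := by
  have h02 : (0 : Fin 3) ≠ 2 := by decide
  have h12 : (1 : Fin 3) ≠ 2 := by decide
  have ha : toFn f (MvPolynomial.pderiv 2 f) *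
      -(toFn f (MvPolynomial.pderiv 0 f) / toFn f (MvPolynomial.pderiv 2 f)) =
      -toFn f (MvPolynomial.pderiv 0 f) := by field_simp
  have hb : toFn f (MvPolynomial.pderiv 2 f) *
      -(toFn f (MvPolynomial.pderiv 1 f) / toFn f (MvPolynomial.pderiv 2 f)) =
      -toFn f (MvPolynomial.pderiv 1 f) := by field_simp
  rw [num₁, Polynomial.map_neg, Polynomial.map_add, Polynomial.map_mul, Polynomial.map_C,
    Polynomial.map_C, Polynomial.map_X, RingHom.coe_coe, osc_one, gD_X_two h2 h02,
    gD_X_two h2 h12, mul_add, mul_left_comm _ X, ← C_mul, ← C_mul, ha, hb, map_neg, map_neg]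
  ring

/-- `N̄₂ = F̄³ T₂`. [folklore] -/
theorem map_num₂ (h2 : toFn f (MvPolynomial.pderiv 2 f) ≠ 0) :
    (num₂ f).map (toFn f : MvPolynomial (Fin 3) K →+* FnField f) =
      C (toFn f (MvPolynomial.pderiv 2 f) ^ 3) * osc f 2 := by
  rw [num₂, Polynomial.map_sub, Polynomial.map_mul, Polynomial.map_mul, map_numDeriv f h2,
    map_numDeriv f h2, map_num₁ f h2, Polynomial.map_C, RingHom.coe_coe, Derivation.leibniz,
    ← osc_succ, smul_eq_mul, smul_eq_mul, map_pow]
  ring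

/-- `N̄₃ = F̄⁵ T₃`. [folklore] -/
theorem map_num₃ (h2 : toFn f (MvPolynomial.pderiv 2 f) ≠ 0) :
    (num₃ f).map (toFn f : MvPolynomial (Fin 3) K →+* FnField f) =
      C (toFn f (MvPolynomial.pderiv 2 f) ^ 5) * osc f 3 := by
  rw [num₃, nsmul_eq_mul, Polynomial.map_sub, Polynomial.map_mul, Polynomial.map_mul,
    Polynomial.map_mul, Polynomial.map_natCast, map_numDeriv f h2, map_numDeriv f h2,
    map_num₂ f h2, Polynomial.map_C, RingHom.coe_coe, Derivation.leibniz, ← osc_succ,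
    slopeDeriv_C, slopeDeriv_C, smul_eq_mul, smul_eq_mul]
  simp only [pow_succ, pow_zero, one_mul, Derivation.leibniz, smul_eq_mul, map_add, map_mul,
    Nat.cast_ofNat]
  ring

end ModF

/-! ### `R(f)` vanishes along the lines of the surface -/

/-- **The chart flecnode polynomial vanishes on lines.** If the line `{p + t v}` with `v₀ = 1`
lies on `{f = 0}` then `R(f)(p) = 0`. (Along the line `𝒟̂P = F·P'`, so `N₁ = v₂ F`,
`N₂ = N₃ = 0`, and `v₁` is a common root of `N₂(p; σ), N₃(p; σ)`.)
[cite: Kollar2015, ¶38–39 (the flecnode polynomial vanishes along every line of the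
surface)] -/
theorem eval_flecRes_eq_zero_of_line (p v : Fin 3 → K) (hv : v 0 = 1)
    (hline : MvPolynomial.aeval (fun i => C (p i) + C (v i) * X) f = 0) :
    MvPolynomial.eval p (flecRes f) = 0 := by
  set Λ : MvPolynomial (Fin 3) K →ₐ[K] K[X] :=
    MvPolynomial.aeval (fun i => C (p i) + C (v i) * X) with hΛ
  -- chain rule `(Λ g)' = Λ ∂₀g + C v₁ Λ ∂₁g + C v₂ Λ ∂₂g`, and `(Λ f)' = 0`
  have hchain : ∀ g, derivative (Λ g) = Λ (MvPolynomial.pderiv 0 g) +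
      C (v 1) * Λ (MvPolynomial.pderiv 1 g) + C (v 2) * Λ (MvPolynomial.pderiv 2 g) := by
    intro g
    have h := derivative_aeval_line p v g
    rw [← hΛ] at h
    rw [h, Fin.sum_univ_three, hv, C_1, one_mul]
  have hf' : Λ (MvPolynomial.pderiv 0 f) + C (v 1) * Λ (MvPolynomial.pderiv 1 f) +
      C (v 2) * Λ (MvPolynomial.pderiv 2 f) = 0 := by
    rw [← hchain, (show Λ f = 0 from hline), derivative_zero]
  -- the numerator derivation along the line: `Λ D̂₀g + C v₁ Λ D̂₁g = ΛF · (Λ g)'`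
  have hD : ∀ g, Λ (tangentDeriv f 0 g) + C (v 1) * Λ (tangentDeriv f 1 g) =
      Λ (MvPolynomial.pderiv 2 f) * derivative (Λ g) := by
    intro g
    rw [tangentDeriv_apply, tangentDeriv_apply, map_sub, map_mul, map_mul, map_sub, map_mul,
      map_mul, hchain]
    linear_combination (-(Λ (MvPolynomial.pderiv 2 g))) * hf'
  -- evaluate `σ` at `v₁` as well
  set Λσ : Polynomial (MvPolynomial (Fin 3) K) →+* K[X] :=
    eval₂RingHom (Λ : MvPolynomial (Fin 3) K →+* K[X]) (C (v 1)) with hΛσ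
  have hΛσC : ∀ g, Λσ (C g) = Λ g := fun g => by
    rw [hΛσ, coe_eval₂RingHom, eval₂_C, RingHom.coe_coe]
  have hΛσX : Λσ X = C (v 1) := by rw [hΛσ, coe_eval₂RingHom, eval₂_X]
  have hNDC : ∀ g, Λσ (numDeriv f (C g)) =
      Λ (MvPolynomial.pderiv 2 f) * derivative (Λσ (C g)) := by
    intro g
    rw [numDeriv_C, map_add, map_mul, hΛσC, hΛσC, hΛσC, hΛσX, hD]
  have hND : ∀ P, Λσ (numDeriv f P) = Λ (MvPolynomial.pderiv 2 f) * derivative (Λσ P) := by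
    intro P
    induction P using Polynomial.induction_on with
    | C g => exact hNDC g
    | add p₁ p₂ h₁ h₂ => rw [map_add, map_add, h₁, h₂, map_add, derivative_add, mul_add]
    | monomial n g _ =>
      rw [numDeriv_C_mul_X_pow, map_mul, map_pow, hΛσX, hNDC, map_mul, map_pow, hΛσX,
        derivative_mul, ← C_pow, derivative_C, mul_zero, add_zero]
      ring
  -- `N₁ ↦ v₂ ΛF`, `N₂ ↦ 0`, `N₃ ↦ 0`
  have hF : Λσ (C (MvPolynomial.pderiv 2 f)) = Λ (MvPolynomial.pderiv 2 f) := hΛσC _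
  have hn₁ : Λσ (num₁ f) = C (v 2) * Λ (MvPolynomial.pderiv 2 f) := by
    rw [num₁, map_neg, map_add, map_mul, hΛσC, hΛσC, hΛσX]
    linear_combination (-1 : K[X]) * hf'
  have hn₂ : Λσ (num₂ f) = 0 := by
    rw [num₂, map_sub, map_mul, map_mul, hND, hND, hF, hn₁, derivative_mul, derivative_C,
      zero_mul, zero_add]
    ring
  have hn₃ : Λσ (num₃ f) = 0 := by
    rw [num₃, map_sub, map_nsmul, map_mul, map_mul, hND, hn₂, derivative_zero, mul_zero,
      mul_zero, zero_mul, smul_zero, sub_zero]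
  -- hence `v₁` is a common root of `N₂(p; σ)` and `N₃(p; σ)`
  have hcomp : (evalRingHom 0).comp (Λ : MvPolynomial (Fin 3) K →+* K[X]) =
      MvPolynomial.eval p := by
    refine RingHom.ext fun g => ?_
    rw [RingHom.comp_apply, coe_evalRingHom, RingHom.coe_coe, hΛ]
    have h := Literature.Combinatorics.Extremal.eval_aeval_line p v g 0
    rwa [zero_smul, add_zero] at h
  have hroot : ∀ P : Polynomial (MvPolynomial (Fin 3) K), Λσ P = 0 →
      (P.map (MvPolynomial.eval p)).eval (v 1) = 0 := by
    intro P hP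
    have h := hom_eval₂ P (Λ : MvPolynomial (Fin 3) K →+* K[X]) (evalRingHom 0) (C (v 1))
    rw [hcomp, coe_evalRingHom, eval_C, (show P.eval₂ (Λ : MvPolynomial (Fin 3) K →+* K[X])
      (C (v 1)) = Λσ P from rfl), hP, eval_zero] at h
    rw [← eval₂_eq_eval_map, ← h]
  -- and the resultant vanishes at `p`
  obtain ⟨u, w, -, -, huw⟩ := exists_mul_add_mul_eq_C_resultant
    ((num₂ f).map (MvPolynomial.eval p)) ((num₃ f).map (MvPolynomial.eval p))
    (natDegree_map_le.trans (natDegree_num₂_le f))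
    (natDegree_map_le.trans (natDegree_num₃_le f)) (Or.inl two_ne_zero)
  have h := congrArg (eval (v 1)) huw
  rw [eval_add, eval_mul, eval_mul, hroot _ hn₂, hroot _ hn₃, zero_mul, zero_mul, zero_add,
    eval_C, resultant_map_map] at h
  rw [flecRes]
  exact h.symm

end Hypersurface

end Literature.RingTheory.MvPolynomial
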